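import Literature.NumberTheory.Transcendental.KZCubicalCalculus
import Literature.NumberTheory.Transcendental.SemialgebraicAlgebraicPoints
import Mathlib.MeasureTheory.Integral.IntervalIntegral.FundThmCalculus
import Mathlib.MeasureTheory.Integral.Prod
import Mathlib.MeasureTheory.Constructions.Pi
import Mathlib.RingTheory.Algebraic.Integral
import HarnessLib

/-!
# `ReducedPeriodRing` (stmt-KontsevichZagierPeriods-3929) — slice functionals of the last-coordinate
Stokes presentation

Line `ayoub-stokes-cartier` of the crux pins its target to the subgroup
`closure (KZ.cubicalLinGens ∪ KZ.cubicalStokesGens)` of `KZ.FormalRep` — ℚ-linearity of the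
integrand on a cube plus Newton–Leibniz along the LAST coordinate of the cube (its `ayoubIdeal`).
This file shows that the quotient by that subgroup remembers much more than periods: for every level
`N` the **slice functional** `FormalRep →+ ℝ`, which integrates a representation over its domain
against the product measure "Dirac mass at `0` in the coordinates `< N`, Lebesgue measure on `[0, ½]`
in coordinate `N`, Lebesgue measure on `[0, 1]` in the coordinates `> N`", takes ALGEBRAIC values on
the whole subgroup (`isAlgebraic_slice_of_mem_closure_lin_stokes`): it vanishes on the linearity
generators, and on a Stokes generator it is `0` (above the Dirac level, by Newton–Leibniz on every
fibre) or a difference of values of the `ℚ`-semialgebraic primitive, resp. integrands, at rational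
points of the cube (at or below it). The companion file `Negative/KernelControlModPi.lean` evaluates
the slice functionals at `π/2` on the `κ`-multiples of a dyadic subdivision relation and refutes the
line's stub `stub_kernelControlModPi`. No definitions: the profile measure, the product measure and
the functional are written out (file-local notations `σₛ[N, i]`, `πₛ[N, n]`, `Sl[N]`).
[Ayoub 2014, Def. 10; Kontsevich–Zagier 2001, §1.2]
-/

noncomputable section

namespace Summit.KontsevichZagierPeriods.KontsevichZagierPeriods.ReducedPeriodRingNegative

open Literature.NumberTheory.Transcendental
open Literature.NumberTheory.Transcendental.KZ hiding cubicalSpan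
open MeasureTheory Set

/-- The slice profile (file-local notation): Dirac mass at `0` for coordinates `i < N`, Lebesgue
measure on `[0, ½]` for `i = N`, Lebesgue measure on `[0, 1]` for `i > N`. -/
local notation3 "σₛ[" N ", " i "]" =>
  (if (i : ℕ) < (N : ℕ) then Measure.dirac (0 : ℝ)
    else if (i : ℕ) = (N : ℕ) then (volume : Measure ℝ).restrict (Set.Icc (0 : ℝ) (1 / 2))
    else (volume : Measure ℝ).restrict (Set.Icc (0 : ℝ) 1))

/-- The slice product measure on `ℝⁿ` of level `N` (file-local notation). -/
local notation3 "πₛ[" N ", " n "]" => Measure.pi fun i : Fin n => σₛ[N, (i : ℕ)]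

/-- The slice functional of level `N` (file-local notation): integrate each representation over its
domain against the slice product measure. -/
local notation3 "Sl[" N "]" =>
  (FreeAbelianGroup.lift fun g : (Σ n, IntegralRep n) =>
    ∫ x in g.2.domain, g.2.integrand x ∂(πₛ[N, g.1]) : FormalRep →+ ℝ)

/-! ## §1 The slice profile -/

/-- Every measure of the slice profile is finite. [folklore] -/
theorem isFiniteMeasure_sliceMeasure (N i : ℕ) : IsFiniteMeasure σₛ[N, i] := by
  split_ifs
  · infer_instance
  · exact isFiniteMeasure_restrict.2 (by simp)
  · exact isFiniteMeasure_restrict.2 (by simp)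

/-- Below level `N` the profile is the Dirac mass at `0`. [folklore] -/
theorem sliceMeasure_of_lt {N i : ℕ} (h : i < N) : σₛ[N, i] = Measure.dirac 0 := by
  simp [h]

/-- At level `N` the profile is Lebesgue measure on `[0, ½]`. [folklore] -/
theorem sliceMeasure_self (N : ℕ) : σₛ[N, N] = volume.restrict (Icc (0 : ℝ) (1 / 2)) := by
  simp

/-- Above level `N` the profile is Lebesgue measure on `[0, 1]`. [folklore] -/
theorem sliceMeasure_of_gt {N i : ℕ} (h : N < i) : σₛ[N, i] = volume.restrict (Icc (0 : ℝ) 1) := by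
  simp [Nat.lt_asymm h, Nat.ne_of_gt h]

/-- Shifting the profile: coordinate `1 + j` at level `N + 1` is coordinate `j` at level `N`. [folklore] -/
theorem sliceMeasure_succ_one_add (N j : ℕ) : σₛ[N + 1, 1 + j] = σₛ[N, j] := by
  rcases Nat.lt_trichotomy j N with h | rfl | h
  · rw [sliceMeasure_of_lt h, sliceMeasure_of_lt (by omega)]
  · rw [sliceMeasure_self, show 1 + j = j + 1 from Nat.add_comm 1 j, sliceMeasure_self]
  · rw [sliceMeasure_of_gt h, sliceMeasure_of_gt (by omega)]

/-- A finite product of Dirac masses at `0` is the Dirac mass at `0`. [folklore] -/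
theorem pi_dirac_zero (n : ℕ) :
    Measure.pi (fun _ : Fin n => Measure.dirac (0 : ℝ)) = Measure.dirac (0 : Fin n → ℝ) := by
  refine Measure.pi_eq fun s hs => ?_
  rw [Measure.dirac_apply' _ (MeasurableSet.univ_pi hs)]
  simp_rw [Measure.dirac_apply' _ (hs _)]
  by_cases h : (0 : Fin n → ℝ) ∈ Set.pi univ s
  · rw [indicator_of_mem h, Finset.prod_eq_one fun i _ => ?_]
    · simp
    · rw [indicator_of_mem (by simpa using h i)]; simp
  · rw [indicator_of_notMem h]
    simp only [mem_univ_pi, not_forall] at h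
    obtain ⟨i, hi⟩ := h
    symm
    have hi' : (0 : ℝ) ∉ s i := by simpa using hi
    exact Finset.prod_eq_zero (Finset.mem_univ i) (indicator_of_notMem hi' _)

/-- In dimension `n ≤ N` the slice product measure is the Dirac mass at the origin. [folklore] -/
theorem slicePi_of_le {N n : ℕ} (h : n ≤ N) : πₛ[N, n] = Measure.dirac 0 := by
  rw [← pi_dirac_zero]
  congr 1
  funext i
  exact sliceMeasure_of_lt (lt_of_lt_of_le i.isLt h)

/-- The slice product measure is finite. [folklore] -/
theorem isFiniteMeasure_slicePi (N n : ℕ) : IsFiniteMeasure πₛ[N, n] := by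
  have := isFiniteMeasure_sliceMeasure N
  infer_instance

/-- The slice functional on a generator. [folklore] -/
theorem slice_of (N : ℕ) {n : ℕ} (r : IntegralRep n) :
    Sl[N] (of r) = ∫ x in r.domain, r.integrand x ∂(πₛ[N, n]) :=
  FreeAbelianGroup.lift_apply_of _ _

/-! ## §2 Splitting off the last coordinate -/

/-- The last-coordinate splitting `ℝⁿ⁺¹ ≃ᵐ ℝ × ℝⁿ` transports the slice product measure of dimension
`n + 1` to the product of the profile measure of coordinate `n` with the slice product measure of
dimension `n`. [folklore] -/
theorem measurePreserving_sliceSplit (N n : ℕ) :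
    MeasurePreserving (MeasurableEquiv.piFinSuccAbove (fun _ : Fin (n + 1) => ℝ) (Fin.last n))
      (πₛ[N, n + 1]) ((σₛ[N, n]).prod (πₛ[N, n])) := by
  have hI := isFiniteMeasure_sliceMeasure N
  have h := measurePreserving_piFinSuccAbove (fun i : Fin (n + 1) => σₛ[N, (i : ℕ)]) (Fin.last n)
  have h2 : (Measure.pi fun j : Fin n => σₛ[N, (((Fin.last n).succAbove j : Fin (n + 1)) : ℕ)]) =
      πₛ[N, n] := by
    congr 1
    funext j
    rw [Fin.succAbove_last, Fin.val_castSucc]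
  rw [h2, Fin.val_last] at h
  exact h

/-- The inverse of the last-coordinate splitting is `(t, y) ↦ (y, t)`. [folklore] -/
theorem sliceSplit_symm_apply (n : ℕ) (p : ℝ × (Fin n → ℝ)) :
    (MeasurableEquiv.piFinSuccAbove (fun _ : Fin (n + 1) => ℝ) (Fin.last n)).symm p =
      Fin.snoc p.2 p.1 := by
  simp [MeasurableEquiv.piFinSuccAbove, Fin.insertNthEquiv, Fin.insertNth_last']

/-- Integration over the cube `[0,1]ⁿ⁺¹` against the slice product measure, pulled back to
`[0,1] × [0,1]ⁿ`. [folklore] -/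
theorem setIntegral_cube_succ (N n : ℕ) (f : (Fin (n + 1) → ℝ) → ℝ) :
    ∫ x in KZ.cube (n + 1), f x ∂(πₛ[N, n + 1]) =
      ∫ p in Icc (0 : ℝ) 1 ×ˢ KZ.cube n, f (Fin.snoc p.2 p.1) ∂((σₛ[N, n]).prod (πₛ[N, n])) := by
  set e := MeasurableEquiv.piFinSuccAbove (fun _ : Fin (n + 1) => ℝ) (Fin.last n) with he
  have hmp := (measurePreserving_sliceSplit N n).symm e
  have hpre : e.symm ⁻¹' KZ.cube (n + 1) = Icc (0 : ℝ) 1 ×ˢ KZ.cube n := by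
    ext p
    rw [mem_preimage, he, sliceSplit_symm_apply, KZ.snoc_mem_cube_iff, mem_prod, mem_Icc]
    tauto
  rw [← hmp.setIntegral_preimage_emb e.symm.measurableEmbedding f (KZ.cube (n + 1)), hpre]
  refine setIntegral_congr_fun (measurableSet_Icc.prod KZ.measurableSet_cube) fun p _ => ?_
  rw [he, sliceSplit_symm_apply]

/-- **Fubini for the slice functional along the last coordinate**: for `f` continuous on the cube,
`∫_{[0,1]ⁿ⁺¹} f dπₛ = ∫_{y ∈ [0,1]ⁿ} ∫_{t ∈ [0,1]} f (y, t) dσₛ(t) dπₛ(y)`. [folklore] -/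
theorem setIntegral_cube_succ_eq_iterated (N n : ℕ) {f : (Fin (n + 1) → ℝ) → ℝ}
    (hf : ContinuousOn f (KZ.cube (n + 1))) :
    ∫ x in KZ.cube (n + 1), f x ∂(πₛ[N, n + 1]) =
      ∫ y in KZ.cube n, (∫ t in Icc (0 : ℝ) 1, f (Fin.snoc y t) ∂(σₛ[N, n])) ∂(πₛ[N, n]) := by
  have hI := isFiniteMeasure_sliceMeasure N
  have hP := isFiniteMeasure_slicePi N n
  rw [setIntegral_cube_succ]
  have hcont : ContinuousOn (fun p : ℝ × (Fin n → ℝ) => f (Fin.snoc p.2 p.1))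
      (Icc (0 : ℝ) 1 ×ˢ KZ.cube n) := by
    refine hf.comp (by fun_prop) ?_
    intro p hp
    exact KZ.snoc_mem_cube_iff.2 ⟨hp.2, hp.1.1, hp.1.2⟩
  have hint : IntegrableOn (fun p : ℝ × (Fin n → ℝ) => f (Fin.snoc p.2 p.1))
      (Icc (0 : ℝ) 1 ×ˢ KZ.cube n) ((σₛ[N, n]).prod (πₛ[N, n])) :=
    hcont.integrableOn_compact (isCompact_Icc.prod KZ.isCompact_cube)
  rw [IntegrableOn, ← Measure.prod_restrict] at hint
  change ∫ p, f (Fin.snoc p.2 p.1) ∂(((σₛ[N, n]).prod (πₛ[N, n])).restrict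
    (Icc (0 : ℝ) 1 ×ˢ KZ.cube n)) = _
  rw [← Measure.prod_restrict, integral_prod_symm _ hint]

/-- The origin lies in the closed unit cube. [folklore] -/
theorem zero_mem_cube (n : ℕ) : (0 : Fin n → ℝ) ∈ KZ.cube n := fun _ => ⟨le_rfl, zero_le_one⟩

/-- `(0, 0) = 0`. [folklore] -/
theorem snoc_zero_zero (n : ℕ) : (Fin.snoc (0 : Fin n → ℝ) (0 : ℝ) : Fin (n + 1) → ℝ) = 0 := by
  ext i
  refine Fin.lastCases ?_ (fun j => ?_) i <;> simp

/-- The coordinates of `(0, …, 0, c)` with `c` rational are algebraic. [folklore] -/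
theorem isAlgebraic_snoc_zero (n : ℕ) (c : ℚ) (i : Fin (n + 1)) :
    IsAlgebraic ℚ ((Fin.snoc (0 : Fin n → ℝ) (c : ℝ) : Fin (n + 1) → ℝ) i) := by
  refine Fin.lastCases ?_ (fun j => ?_) i
  · simpa using isAlgebraic_algebraMap (R := ℚ) (A := ℝ) c
  · simpa using (isAlgebraic_zero : IsAlgebraic ℚ (0 : ℝ))

/-- `(0, …, 0, c) ∈ [0,1]ⁿ⁺¹` for `0 ≤ c ≤ 1`. [folklore] -/
theorem snoc_zero_mem_cube (n : ℕ) {c : ℝ} (h0 : 0 ≤ c) (h1 : c ≤ 1) :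
    (Fin.snoc (0 : Fin n → ℝ) c : Fin (n + 1) → ℝ) ∈ KZ.cube (n + 1) :=
  KZ.snoc_mem_cube_iff.2 ⟨zero_mem_cube n, h0, h1⟩

/-- Restricting Lebesgue measure to `[0, b] ⊆ [0, 1]` and integrating over `[0, 1]` is integrating
over `[0, b]`. [folklore] -/
theorem setIntegral_Icc_restrict_Icc (φ : ℝ → ℝ) {b : ℝ} (hb1 : b ≤ 1) :
    ∫ t in Icc (0 : ℝ) 1, φ t ∂(volume.restrict (Icc 0 b)) = ∫ t in Icc (0 : ℝ) b, φ t := by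
  rw [Measure.restrict_restrict measurableSet_Icc,
    Set.inter_eq_right.2 (Icc_subset_Icc le_rfl hb1)]

/-- **Newton–Leibniz on a fibre of the cube**: `∫_{[0,b]} ∂ₜF (y, t) dt = F (y, b) − F (y, 0)`.
[Kontsevich–Zagier 2001, §1.2 rule (3)] -/
theorem integral_Icc_snoc_eq {n : ℕ} {f F : (Fin (n + 1) → ℝ) → ℝ}
    (hf : ContinuousOn f (KZ.cube (n + 1)))
    (hderiv : ∀ x ∈ KZ.cube n, ∀ t ∈ Icc (0 : ℝ) 1,
      HasDerivAt (fun s : ℝ => F (Fin.snoc x s)) (f (Fin.snoc x t)) t)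
    {y : Fin n → ℝ} (hy : y ∈ KZ.cube n) {b : ℝ} (hb0 : 0 ≤ b) (hb1 : b ≤ 1) :
    ∫ t in Icc (0 : ℝ) b, f (Fin.snoc y t) = F (Fin.snoc y b) - F (Fin.snoc y 0) := by
  have hcont : ContinuousOn (fun t : ℝ => f (Fin.snoc y t)) (Icc 0 1) := by
    refine hf.comp (by fun_prop) ?_
    intro t ht
    exact KZ.snoc_mem_cube_iff.2 ⟨hy, ht.1, ht.2⟩
  rw [integral_Icc_eq_integral_Ioc, ← intervalIntegral.integral_of_le hb0]
  refine intervalIntegral.integral_eq_sub_of_hasDerivAt (fun t ht => hderiv y hy t ?_) ?_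
  · rw [uIcc_of_le hb0] at ht
    exact ⟨ht.1, ht.2.trans hb1⟩
  · exact ((hcont.mono (Icc_subset_Icc le_rfl hb1)).intervalIntegrable_of_Icc hb0)

/-! ## §3 The slice functional is algebraic on the linearity and last-coordinate Stokes generators -/

/-- Tame integrands are integrable on the cube against the slice product measure (continuous on a
compact set, finite measure). [folklore] -/
theorem integrableOn_cube_slicePi (N : ℕ) {n : ℕ} {f : (Fin n → ℝ) → ℝ}
    (hf : AnalyticOnNhd ℝ f (KZ.cube n)) : IntegrableOn f (KZ.cube n) (πₛ[N, n]) := by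
  have hP := isFiniteMeasure_slicePi N n
  exact hf.continuousOn.integrableOn_compact KZ.isCompact_cube

/-- **The slice functional kills the linearity generators.** [Kontsevich–Zagier 2001, §1.2 rule (1)] -/
theorem slice_eq_zero_of_mem_cubicalLinGens (N : ℕ) {c : FormalRep} (hc : c ∈ KZ.cubicalLinGens) :
    Sl[N] c = 0 := by
  obtain ⟨n, r, r₁, r₂, hr, -, hr₁, hr₁a, hr₂, hr₂a, hadd, rfl⟩ := hc
  simp only [map_sub, slice_of, hr, hr₁, hr₂]
  rw [setIntegral_congr_fun KZ.measurableSet_cube hadd,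
    integral_add' (integrableOn_cube_slicePi N hr₁a) (integrableOn_cube_slicePi N hr₂a)]
  ring

/-- **The slice functional is algebraic on the last-coordinate Stokes generators**: it is `0` above
the Dirac level (Newton–Leibniz on every fibre), and a difference of values of the `ℚ`-semialgebraic
primitive (resp. of the integrands) at rational points of the cube at or below it. [Ayoub 2014, Def. 10] -/
theorem isAlgebraic_slice_of_mem_cubicalStokesGens (N : ℕ) {c : FormalRep}
    (hc : c ∈ KZ.cubicalStokesGens) : IsAlgebraic ℚ (Sl[N] c) := by
  classical
  obtain ⟨n, r, r', F, hr, hra, hr', -, -, hFs, hderiv, hr'F, rfl⟩ := hc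
  rw [map_sub, slice_of, slice_of, hr, hr', setIntegral_cube_succ_eq_iterated N n hra.continuousOn]
  rcases Nat.lt_trichotomy n N with hlt | rfl | hgt
  · -- below the Dirac level: two point evaluations at the origin
    rw [sliceMeasure_of_lt hlt, slicePi_of_le hlt.le, setIntegral_dirac, if_pos (zero_mem_cube n),
      setIntegral_dirac, if_pos (show (0 : ℝ) ∈ Icc (0 : ℝ) 1 from ⟨le_rfl, zero_le_one⟩),
      setIntegral_dirac, if_pos (zero_mem_cube n), snoc_zero_zero]
    refine IsAlgebraic.sub ?_ ?_
    · exact r.isSemialgebraicFunOn_integrand.isAlgebraic_apply (by rw [hr]; exact zero_mem_cube _)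
        fun _ => isAlgebraic_zero
    · exact r'.isSemialgebraicFunOn_integrand.isAlgebraic_apply (by rw [hr']; exact zero_mem_cube _)
        fun _ => isAlgebraic_zero
  · -- at the Dirac level: the primitive at `(0, ½)`, `(0, 1)` and `(0, 0)`
    rw [sliceMeasure_self, slicePi_of_le le_rfl, setIntegral_dirac, if_pos (zero_mem_cube n),
      setIntegral_dirac, if_pos (zero_mem_cube n),
      setIntegral_Icc_restrict_Icc _ (by norm_num : (1 / 2 : ℝ) ≤ 1),
      integral_Icc_snoc_eq (b := (1 / 2 : ℝ)) hra.continuousOn hderiv (zero_mem_cube n) (by norm_num)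
        (by norm_num),
      hr'F 0 (zero_mem_cube n)]
    have h := fun (c : ℚ) (h0 : (0 : ℝ) ≤ c) (h1 : (c : ℝ) ≤ 1) =>
      hFs.isAlgebraic_apply (snoc_zero_mem_cube n h0 h1) (isAlgebraic_snoc_zero n c)
    have h12 := h (1 / 2) (by norm_num) (by norm_num)
    have h1 := h 1 (by norm_num) (by norm_num)
    have h0 := h 0 (by norm_num) (by norm_num)
    push_cast at h12 h1 h0
    exact (h12.sub h0).sub (h1.sub h0)
  · -- above the Dirac level: Newton–Leibniz on every fibre, the generator evaluates to `0`
    rw [sliceMeasure_of_gt hgt]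
    have hJ : EqOn (fun y => ∫ t in Icc (0 : ℝ) 1, r.integrand (Fin.snoc y t)
        ∂(volume.restrict (Icc (0 : ℝ) 1))) r'.integrand (KZ.cube n) := by
      intro y hy
      simp only
      rw [setIntegral_Icc_restrict_Icc _ le_rfl,
        integral_Icc_snoc_eq (b := (1 : ℝ)) hra.continuousOn hderiv hy zero_le_one le_rfl, hr'F y hy]
    rw [setIntegral_congr_fun KZ.measurableSet_cube hJ, sub_self]
    exact isAlgebraic_zero

/-- **The slice functionals take algebraic values on `closure (cubicalLinGens ∪ cubicalStokesGens)`**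
(the `ayoubIdeal` of line `ayoub-stokes-cartier`), at every level `N`. [Ayoub 2014, Def. 10] -/
theorem isAlgebraic_slice_of_mem_closure_lin_stokes (N : ℕ) {x : FormalRep}
    (hx : x ∈ AddSubgroup.closure (KZ.cubicalLinGens ∪ KZ.cubicalStokesGens)) :
    IsAlgebraic ℚ (Sl[N] x) := by
  induction hx using AddSubgroup.closure_induction with
  | mem x hx =>
    rcases hx with hx | hx
    · rw [slice_eq_zero_of_mem_cubicalLinGens N hx]; exact isAlgebraic_zero
    · exact isAlgebraic_slice_of_mem_cubicalStokesGens N hx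
  | zero => rw [map_zero]; exact isAlgebraic_zero
  | add x y _ _ hx hy => rw [map_add]; exact hx.add hy
  | neg x _ hx => rw [map_neg]; exact hx.neg

end Summit.KontsevichZagierPeriods.KontsevichZagierPeriods.ReducedPeriodRingNegative

end
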